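import Mathlib
import Summits.NavierStokesRegularity.NavierStokesRegularity.Theorems.FilamentSkeletonRssAnalyticStripLiaSymbolSeriesSound
import Summits.NavierStokesRegularity.NavierStokesRegularity.Theorems.FilamentSkeletonRssAnalyticStripLiaSymbolNumericsSound
import Summits.NavierStokesRegularity.NavierStokesRegularity.Theorems.FilamentSkeletonRssAnalyticStripLiaSymbolAsymp

/-!
# Stub P3 `LiaSymbolBound` — KERNEL-ONLY numerics, brick 5b: SOUNDNESS II — the alternating sums and the enclosures
# `ELo p k ≤ E(p) ≤ EHi p k`, `CLo p k ≤ C(p) ≤ CHi p k` of the rational series checker (`…LiaSymbolSeriesDefs`)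

Hand leafhand-ns-filamentskeletonrs-7 g1 (prover), 2026-08-31, `--supports stmt-NavierStokesRegularity-23320 --as helper` (tenure P5-(B)).
Standard axioms.  §1 `nearS`/`farS` enclose the alternating partial sums of bricks 3/2 (parity split, moment enclosures `alphaB`/`betaB`
of brick 5a); §2 `E(p) = ∫_{(0,1]} + ∫_{(1,∞)}` (`Numerics.Eint`, `Numerics.Cint` of `…NumericsDefs`), near/far expansions with `M = 12`,
`N = 16` even ⇒ `E_encl`, `C_encl` for every admissible node `(p, k)`.  The cells, the certificate and the window: `…SeriesWindow`.

HONEST FRAMING: certified numerics for one explicit real integral, serving a HYPOTHETICAL filament-skeleton line on the NEGATIVE side of a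
MODEL route; nothing here bears on Navier–Stokes regularity or blow-up.
-/

set_option linter.dupNamespace false

noncomputable section

namespace Summit.NavierStokesRegularity.NavierStokesRegularity.Theorems.AnalyticStripLiaSymbol

namespace Series

open Real Set MeasureTheory Filter Topology Finset
open Literature.NumberTheory.Sieve

/-! ## §1  The alternating partial sums -/

/-- **Soundness of `nearS`**: it encloses `Σ_{i<n} (−1)^i/i!·α_{i+j}(p)`. -/
theorem nearS_encl (p : ℚ) (k : ℤ) (hp : 0 < p) (hok : logOK p k = true) (j : ℕ) : ∀ n : ℕ,
    (((nearS p k j n).1 : ℚ) : ℝ) ≤ (∑ i ∈ range n, (-1 : ℝ) ^ i / (i.factorial : ℝ) *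
        ∫ t in Ioc (0:ℝ) 1, Real.exp (-((p:ℝ) / t)) * t ^ (i + j) / t) ∧
      (∑ i ∈ range n, (-1 : ℝ) ^ i / (i.factorial : ℝ) *
        ∫ t in Ioc (0:ℝ) 1, Real.exp (-((p:ℝ) / t)) * t ^ (i + j) / t) ≤ (((nearS p k j n).2 : ℚ) : ℝ) := by
  intro n
  induction n with
  | zero => simp [nearS]
  | succ n ih =>
    obtain ⟨ih1, ih2⟩ := ih
    obtain ⟨ha1, ha2⟩ := alphaB_encl p k hp hok (n + j)
    rw [sum_range_succ]
    set S := ∑ i ∈ range n, (-1 : ℝ) ^ i / (i.factorial : ℝ) *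
        ∫ t in Ioc (0:ℝ) 1, Real.exp (-((p:ℝ) / t)) * t ^ (i + j) / t with hS
    set A := ∫ t in Ioc (0:ℝ) 1, Real.exp (-((p:ℝ) / t)) * t ^ (n + j) / t with hA
    have hf : (0:ℝ) < (n.factorial : ℝ) := by positivity
    by_cases hpar : n % 2 = 0
    · have hev : (-1 : ℝ) ^ n = 1 := (Nat.even_iff.mpr hpar).neg_one_pow
      simp only [nearS, if_pos hpar]
      push_cast
      rw [hev, one_div]
      have h1 : (((alphaB p k (n + j)).1 : ℚ) : ℝ) / (n.factorial : ℝ) ≤ (n.factorial : ℝ)⁻¹ * A := by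
        rw [inv_mul_eq_div]; exact div_le_div_of_nonneg_right ha1 hf.le
      have h2 : (n.factorial : ℝ)⁻¹ * A ≤ (((alphaB p k (n + j)).2 : ℚ) : ℝ) / (n.factorial : ℝ) := by
        rw [inv_mul_eq_div]; exact div_le_div_of_nonneg_right ha2 hf.le
      constructor <;> linarith
    · have hod : (-1 : ℝ) ^ n = -1 := (Nat.odd_iff.mpr (by omega)).neg_one_pow
      simp only [nearS, if_neg hpar]
      push_cast
      rw [hod]
      have h1 : (((alphaB p k (n + j)).1 : ℚ) : ℝ) / (n.factorial : ℝ) ≤ A / (n.factorial : ℝ) :=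
        div_le_div_of_nonneg_right ha1 hf.le
      have h2 : A / (n.factorial : ℝ) ≤ (((alphaB p k (n + j)).2 : ℚ) : ℝ) / (n.factorial : ℝ) :=
        div_le_div_of_nonneg_right ha2 hf.le
      have he : (-1 : ℝ) / (n.factorial : ℝ) * A = -(A / (n.factorial : ℝ)) := by ring
      rw [he]
      constructor <;> linarith

/-- **Soundness of `farS`**: it encloses `Σ_{i<n} (−p)^i/i!·β_{i+j}` (`p ≥ 0`). -/
theorem farS_encl (p : ℚ) (hp : 0 ≤ p) (j : ℕ) : ∀ n : ℕ,
    (((farS p j n).1 : ℚ) : ℝ) ≤ (∑ i ∈ range n, (-(p:ℝ)) ^ i / (i.factorial : ℝ) *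
        ∫ t in Ioi (1:ℝ), Real.exp (-t) * t ^ (-((i + j : ℕ):ℤ))) ∧
      (∑ i ∈ range n, (-(p:ℝ)) ^ i / (i.factorial : ℝ) *
        ∫ t in Ioi (1:ℝ), Real.exp (-t) * t ^ (-((i + j : ℕ):ℤ))) ≤ (((farS p j n).2 : ℚ) : ℝ) := by
  have hp' : (0:ℝ) ≤ p := by exact_mod_cast hp
  intro n
  induction n with
  | zero => simp [farS]
  | succ n ih =>
    obtain ⟨ih1, ih2⟩ := ih
    obtain ⟨hb1, hb2⟩ := betaB_encl (n + j)
    rw [sum_range_succ, neg_pow]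
    set S := ∑ i ∈ range n, (-(p:ℝ)) ^ i / (i.factorial : ℝ) *
        ∫ t in Ioi (1:ℝ), Real.exp (-t) * t ^ (-((i + j : ℕ):ℤ)) with hS
    set B := ∫ t in Ioi (1:ℝ), Real.exp (-t) * t ^ (-((n + j : ℕ):ℤ)) with hB
    have hq : (0:ℝ) ≤ (p:ℝ) ^ n / (n.factorial : ℝ) := by positivity
    by_cases hpar : n % 2 = 0
    · have hev : (-1 : ℝ) ^ n = 1 := (Nat.even_iff.mpr hpar).neg_one_pow
      simp only [farS, if_pos hpar]
      push_cast
      rw [hev, one_mul]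
      have h1 := mul_le_mul_of_nonneg_left hb1 hq
      have h2 := mul_le_mul_of_nonneg_left hb2 hq
      constructor <;> linarith
    · have hod : (-1 : ℝ) ^ n = -1 := (Nat.odd_iff.mpr (by omega)).neg_one_pow
      simp only [farS, if_neg hpar]
      push_cast
      rw [hod]
      have h1 := mul_le_mul_of_nonneg_left hb1 hq
      have h2 := mul_le_mul_of_nonneg_left hb2 hq
      have he : -1 * (p:ℝ) ^ n / (n.factorial : ℝ) * B = -((p:ℝ) ^ n / (n.factorial : ℝ) * B) := by ring
      rw [he]
      constructor <;> linarith

/-! ## §2  The enclosures of `E(p)` and `C(p)` -/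

/-- Splitting `∫_{(0,∞)} = ∫_{(0,1]} + ∫_{(1,∞)}`. -/
theorem integral_Ioi_zero_split {g : ℝ → ℝ} (hg : IntegrableOn g (Ioi 0)) :
    ∫ t in Ioi (0:ℝ), g t = (∫ t in Ioc (0:ℝ) 1, g t) + ∫ t in Ioi (1:ℝ), g t := by
  rw [← setIntegral_union (Set.Ioc_disjoint_Ioi le_rfl) measurableSet_Ioi
    (hg.mono_set Ioc_subset_Ioi_self) (hg.mono_set (Ioi_subset_Ioi zero_le_one)), Ioc_union_Ioi_eq_Ioi zero_le_one]

/-- **`ELo p k ≤ E(p) ≤ EHi p k`** for an admissible node. -/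
theorem E_encl (p : ℚ) (k : ℤ) (hp : 0 < p) (hok : logOK p k = true) :
    ((ELo p k : ℚ) : ℝ) ≤ Numerics.Eint (p:ℝ) ∧ Numerics.Eint (p:ℝ) ≤ ((EHi p k : ℚ) : ℝ) := by
  have hp' : (0:ℝ) < p := by exact_mod_cast hp
  -- split `E = near + far`
  have hsplit : Numerics.Eint (p:ℝ) = (∫ t in Ioc (0:ℝ) 1, Real.exp (-t) * (Real.exp (-((p:ℝ) / t)) * t ^ 0 / t))
      + ∫ t in Ioi (1:ℝ), Real.exp (-t) * t ^ (-((1:ℕ):ℤ)) * Real.exp (-((p:ℝ) / t)) := by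
    rw [Numerics.Eint, integral_Ioi_zero_split (integrableOn_E_integrand hp')]
    congr 1
    · refine setIntegral_congr_fun measurableSet_Ioc (fun t _ => ?_)
      rw [pow_zero, mul_one, mul_div_assoc]
    · refine setIntegral_congr_fun measurableSet_Ioi (fun t ht => ?_)
      have ht0 : (t:ℝ) ≠ 0 := by have : (1:ℝ) < t := ht; positivity
      simp only [Nat.cast_one, zpow_neg, zpow_one]
      rw [div_eq_mul_inv]; ring
  have hnear := near_expansion 0 12 hp'
  have hfar := far_expansion 1 16 hp'.le
  have h12 : (-1 : ℝ) ^ 12 = 1 := by norm_num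
  have h16 : (-1 : ℝ) ^ 16 = 1 := by norm_num
  simp only [h12, one_mul, add_zero] at hnear
  simp only [h16, one_mul] at hfar
  obtain ⟨hn1, hn2⟩ := hnear
  obtain ⟨hf1, hf2⟩ := hfar
  obtain ⟨hs1, hs2⟩ := nearS_encl p k hp hok 0 12
  obtain ⟨ht1, ht2⟩ := farS_encl p hp.le 1 16
  obtain ⟨-, ha2⟩ := alphaB_encl p k hp hok 12
  obtain ⟨-, hb2⟩ := betaB_encl 17
  simp only [add_zero] at hs1 hs2
  have hq : (0:ℝ) ≤ (p:ℝ) ^ 16 / ((16).factorial : ℝ) := by positivity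
  have hbb := mul_le_mul_of_nonneg_left hb2 hq
  have hf12 : (0:ℝ) < ((12).factorial : ℝ) := by positivity
  have haa := div_le_div_of_nonneg_right ha2 hf12.le
  unfold ELo EHi
  push_cast
  rw [hsplit]
  constructor <;> linarith

/-- **`CLo p k ≤ C(p) ≤ CHi p k`** for an admissible node. -/
theorem C_encl (p : ℚ) (k : ℤ) (hp : 0 < p) (hok : logOK p k = true) :
    ((CLo p k : ℚ) : ℝ) ≤ Numerics.Cint (p:ℝ) ∧ Numerics.Cint (p:ℝ) ≤ ((CHi p k : ℚ) : ℝ) := by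
  have hp' : (0:ℝ) < p := by exact_mod_cast hp
  have hsplit : Numerics.Cint (p:ℝ) = (∫ t in Ioc (0:ℝ) 1, Real.exp (-t) * (Real.exp (-((p:ℝ) / t)) * t ^ 1 / t))
      + ∫ t in Ioi (1:ℝ), Real.exp (-t) * t ^ (-((0:ℕ):ℤ)) * Real.exp (-((p:ℝ) / t)) := by
    rw [Numerics.Cint, integral_Ioi_zero_split (Numerics.integrableOn_fC hp'.le)]
    congr 1
    · refine setIntegral_congr_fun measurableSet_Ioc (fun t ht => ?_)
      have ht0 : (t:ℝ) ≠ 0 := ht.1.ne'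
      rw [pow_one, mul_div_assoc, div_self ht0, mul_one]
    · refine setIntegral_congr_fun measurableSet_Ioi (fun t _ => ?_)
      simp
  have hnear := near_expansion 1 12 hp'
  have hfar := far_expansion 0 16 hp'.le
  have h12 : (-1 : ℝ) ^ 12 = 1 := by norm_num
  have h16 : (-1 : ℝ) ^ 16 = 1 := by norm_num
  simp only [h12, one_mul] at hnear
  simp only [h16, one_mul, add_zero] at hfar
  obtain ⟨hn1, hn2⟩ := hnear
  obtain ⟨hf1, hf2⟩ := hfar
  obtain ⟨hs1, hs2⟩ := nearS_encl p k hp hok 1 12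
  obtain ⟨ht1, ht2⟩ := farS_encl p hp.le 0 16
  obtain ⟨-, ha2⟩ := alphaB_encl p k hp hok 13
  obtain ⟨-, hb2⟩ := betaB_encl 16
  simp only [add_zero] at ht1 ht2
  have hq : (0:ℝ) ≤ (p:ℝ) ^ 16 / ((16).factorial : ℝ) := by positivity
  have hbb := mul_le_mul_of_nonneg_left hb2 hq
  have hf12 : (0:ℝ) < ((12).factorial : ℝ) := by positivity
  have haa := div_le_div_of_nonneg_right ha2 hf12.le
  unfold CLo CHi
  push_cast
  rw [hsplit]
  constructor <;> linarith

end Series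

end Summit.NavierStokesRegularity.NavierStokesRegularity.Theorems.AnalyticStripLiaSymbol

end
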